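import Literature.AlgebraicGeometry.Milne1999.MumfordTateGroupIsogeny
import Literature.AlgebraicGeometry.ComplexMultiplication.EndomorphismFieldNondegenerateType
import Literature.AlgebraicGeometry.HodgeTheory.ExceptionalClassesProductFactors
import Literature.AlgebraicGeometry.Motives.AbelianVarietyProductDimProofs
import HarnessLib

/-!
# Milne's Prop. 4.8 conditions `Hg(A) = L(A)`, `Hg′(A) = S(A)` pass to and from powers, mixed powers of a
# product, and anything isogenous to a power; they descend to the factors of a product

Milne [Milne1999LefschetzClasses, Prop. 4.8 (p. 660)]: for an abelian variety `A` the following are equivalent: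
(a) no power of `A` supports an exotic Hodge class; (b) `Hg(A) = L(A)`; (c) `Hg′(A) = S(A)`. The tree has
(a) ⟺ (b) ⟺ (c) (`AbelianVariety.hodgeGroup_eq_specialLefschetzGroup_iff_forall_isDivisorGenerated`,
`AbelianVariety.mumfordTateGroup_eq_lefschetzGroup_iff_forall_isDivisorGenerated`, on Milne's families
`HodgeTheory.hodgeGroup` / `mumfordTateGroup` vs `Milne1999.specialLefschetzGroup` / `lefschetzGroup`), condition (a) as
the predicate `HodgeTheory.IsStablyNondegenerate` («`B = D` on every power», Gordon Thm. 7.5 / Def. 7.6, Moonen–Zarhin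
condition (D)) with `IsStablyNondegenerate.powSucc` / `isStablyNondegenerate_powSucc_iff` / `.powSucc_prod_powSucc` /
`.of_isIsogenous`, and `IsDivisorGenerated.left_of_prod` / `right_of_prod` (van Geemen §2.5: an exceptional class of a
factor pulls back to an exceptional class of the product).

This file (all `theorem`s, no definition, no named fact) draws the consequences for Milne's GROUPS, at the level of the
families (all degrees, not only `H¹`):
* §1 condition (a) descends to the factors of a product and ascends from mixed powers:
  `IsStablyNondegenerate.left_of_prod` / `right_of_prod`, `IsStablyNondegenerate.of_powSucc_prod_powSucc`
  (`A × B` is a retract of `A^{M+1} × B^{N+1}`), `isStablyNondegenerate_powSucc_prod_powSucc_iff`;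
* §2 **`Hg′(A^{r+1}) = S(A^{r+1}) ⟺ Hg′(A) = S(A)`**, **`Hg(A^{r+1}) = L(A^{r+1}) ⟺ Hg(A) = L(A)`** (and the strict
  `Hg(A^{r+1}) ⊊ L(A^{r+1}) ⟺ Hg(A) ⊊ L(A)`), the same for every `X` isogenous to `A^{r+1}`;
* §3 **`Hg′(A × B) = S(A × B) ⟹ Hg′(A) = S(A) ∧ Hg′(B) = S(B)`**, `Hg(A × B) = L(A × B) ⟹ Hg(A) = L(A)` (positive-dimensional
  factor), and **`Hg′(A^{M+1} × B^{N+1}) = S(A^{M+1} × B^{N+1}) ⟺ Hg′(A × B) = S(A × B)`** with its `Hg = L` form.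
(The converse of §3's first statement is false in general — `A × B` may acquire exotic classes, e.g. Weil type — and is
not asserted.)

## References

* [Milne1999LefschetzClasses] J. S. Milne, *Lefschetz classes on abelian varieties*, Duke Math. J. 96 (1999), Prop. 4.8
  and Remark 4.9 (p. 660), Cor. 4.5, Cor. 4.7.
* [vanGeemen1994HodgeAV] B. van Geemen, *An introduction to the Hodge conjecture for abelian varieties* (1994), §2.4–2.5
  (p. 235), §3.6–3.7 (p. 236).
* [Gordon1999HodgeAVSurvey] B. B. Gordon, *A survey of the Hodge conjecture for abelian varieties* (1999), Thm. 7.5, Def. 7.6.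
* [MoonenZarhin1999LowDim] B. Moonen, Yu. G. Zarhin, Math. Ann. 315 (1999), §1 and §2 condition (D).
-/

noncomputable section

open CategoryTheory
open Literature.AlgebraicTopology.SingularHomology
open Literature.AlgebraicGeometry.Motives
open Literature.AlgebraicGeometry.HodgeTheory

/-! ### §1 Condition (a) — `B = D` on every power — on factors and mixed powers -/

namespace Literature.AlgebraicGeometry.HodgeTheory

variable {A B : AbelianVariety ℂ}

/-- **`B = D` on every power of `A × B` forces `B = D` on every power of `A`**: `A^{N+1}` is a factor of
`A^{N+1} × B` (`IsStablyNondegenerate.powSucc_prod_powSucc`, `IsDivisorGenerated.left_of_prod`).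
[cite: vanGeemen1994HodgeAV, §2.4–2.5 (p. 235) and §3.6–3.7 (p. 236)] [cite: MoonenZarhin1999LowDim, §1] -/
theorem IsStablyNondegenerate.left_of_prod (h : IsStablyNondegenerate (A.prod B)) : IsStablyNondegenerate A :=
  fun N ↦ ((h.powSucc_prod_powSucc N 0) 0).left_of_prod

/-- **`B = D` on every power of `A × B` forces `B = D` on every power of `B`.**
[cite: vanGeemen1994HodgeAV, §2.4–2.5 (p. 235) and §3.6–3.7 (p. 236)] [cite: MoonenZarhin1999LowDim, §1] -/
theorem IsStablyNondegenerate.right_of_prod (h : IsStablyNondegenerate (A.prod B)) : IsStablyNondegenerate B :=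
  fun N ↦ ((h.powSucc_prod_powSucc 0 N) 0).right_of_prod

variable (A B) in
/-- `A × B` is a retract of `A^{M+1} × B^{N+1}`: (diagonal, diagonal) followed by (first projection, first projection) is
the identity. [cite: vanGeemen1994HodgeAV, §3.6–3.7 (p. 236)] -/
theorem prodLift_diag_comp_prodLift_proj (M N : ℕ) :
    AbelianVariety.prodLift (AbelianVariety.fst A B ≫ Milne1999.powLift M fun _ ↦ 𝟙 A)
        (AbelianVariety.snd A B ≫ Milne1999.powLift N fun _ ↦ 𝟙 B) ≫
      AbelianVariety.prodLift (AbelianVariety.fst (A.powSucc M) (B.powSucc N) ≫ Milne1999.powProj A M 0)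
        (AbelianVariety.snd (A.powSucc M) (B.powSucc N) ≫ Milne1999.powProj B N 0) = 𝟙 (A.prod B) := by
  apply AbelianVariety.prod_hom_ext
  · rw [Category.assoc, AbelianVariety.prodLift_fst, ← Category.assoc, AbelianVariety.prodLift_fst, Category.assoc,
      Milne1999.powLift_powProj, Category.comp_id, Category.id_comp]
  · rw [Category.assoc, AbelianVariety.prodLift_snd, ← Category.assoc, AbelianVariety.prodLift_snd, Category.assoc,
      Milne1999.powLift_powProj, Category.comp_id, Category.id_comp]

/-- **`B = D` on every power of `A^{M+1} × B^{N+1}` forces `B = D` on every power of `A × B`** (`A × B` is a retract of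
`A^{M+1} × B^{N+1}`; `IsStablyNondegenerate.of_retract_powSucc`). [cite: vanGeemen1994HodgeAV, §2.4–2.5 (p. 235) and §3.6–3.7 (p. 236)] -/
theorem IsStablyNondegenerate.of_powSucc_prod_powSucc {M N : ℕ}
    (h : IsStablyNondegenerate ((A.powSucc M).prod (B.powSucc N))) : IsStablyNondegenerate (A.prod B) :=
  IsStablyNondegenerate.of_retract_powSucc (P := (A.powSucc M).prod (B.powSucc N)) (K₀ := 0) _ _
    (prodLift_diag_comp_prodLift_proj A B M N) h

variable (A B) in
/-- `A^{M+1} × B^{N+1}` has `B = D` on every power iff `A × B` does. [cite: vanGeemen1994HodgeAV, §2.4–2.5 (p. 235) and §3.6–3.7 (p. 236)]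
[cite: Gordon1999HodgeAVSurvey, Thm. 7.5 and Def. 7.6] -/
theorem isStablyNondegenerate_powSucc_prod_powSucc_iff (M N : ℕ) :
    IsStablyNondegenerate ((A.powSucc M).prod (B.powSucc N)) ↔ IsStablyNondegenerate (A.prod B) :=
  ⟨IsStablyNondegenerate.of_powSucc_prod_powSucc, fun h ↦ h.powSucc_prod_powSucc M N⟩

/-- `B = D` on every power is invariant under isogeny (iff form of the tree's `IsStablyNondegenerate.of_isIsogenous`).
[cite: vanGeemen1994HodgeAV, §3.6–3.7 (p. 236)] -/
theorem isStablyNondegenerate_iff_of_isIsogenous (h : AbelianVariety.IsIsogenous A B) :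
    IsStablyNondegenerate A ↔ IsStablyNondegenerate B :=
  ⟨fun hA ↦ hA.of_isIsogenous' h, fun hB ↦ hB.of_isIsogenous h⟩

end Literature.AlgebraicGeometry.HodgeTheory

namespace Literature.AlgebraicGeometry.Milne1999

/-! ### §2 Powers and their isogeny class -/

section Powers

variable {X : AbelianVariety ℂ} (A : AbelianVariety ℂ)

/-- **`Hg′(A^{r+1}) = S(A^{r+1}) ⟺ Hg′(A) = S(A)`** (Milne's Prop. 4.8 (c) for a power): both say «no power supports an
exotic Hodge class», and the powers of `A^{r+1}` and of `A` have `B = D` together (`isStablyNondegenerate_powSucc_iff`).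
[cite: Milne1999LefschetzClasses, Prop. 4.8 (p. 660) and Cor. 4.7] [cite: vanGeemen1994HodgeAV, §3.6–3.7 (p. 236)] -/
theorem _root_.Literature.AlgebraicGeometry.Motives.AbelianVariety.hodgeGroup_powSucc_eq_specialLefschetzGroup_iff (r : ℕ) :
    hodgeGroup (A.powSucc r).dim (A.powSucc r).X = specialLefschetzGroup (A.powSucc r).dim (A.powSucc r).X ↔
      hodgeGroup A.dim A.X = specialLefschetzGroup A.dim A.X := by
  rw [(A.powSucc r).hodgeGroup_eq_specialLefschetzGroup_iff_forall_isDivisorGenerated,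
    A.hodgeGroup_eq_specialLefschetzGroup_iff_forall_isDivisorGenerated, ← isStablyNondegenerate_iff,
    ← isStablyNondegenerate_iff, isStablyNondegenerate_powSucc_iff]

variable {A} in
/-- **`Hg(A^{r+1}) = L(A^{r+1}) ⟺ Hg(A) = L(A)`** (Milne's Prop. 4.8 (b) for a power; `dim A ≥ 1`).
[cite: Milne1999LefschetzClasses, Prop. 4.8 (p. 660) and Cor. 4.7] [cite: MoonenZarhin1999LowDim, §1] -/
theorem _root_.Literature.AlgebraicGeometry.Motives.AbelianVariety.mumfordTateGroup_powSucc_eq_lefschetzGroup_iff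
    (hA : 1 ≤ A.dim) (r : ℕ) :
    mumfordTateGroup (A.powSucc r).dim (A.powSucc r).X = lefschetzGroup (A.powSucc r).dim (A.powSucc r).X ↔
      mumfordTateGroup A.dim A.X = lefschetzGroup A.dim A.X := by
  rw [← (A.powSucc r).hodgeGroup_eq_specialLefschetzGroup_iff (dim_powSucc_pos hA r),
    ← A.hodgeGroup_eq_specialLefschetzGroup_iff hA]
  exact A.hodgeGroup_powSucc_eq_specialLefschetzGroup_iff r

variable {A} in
/-- **`Hg(A^{r+1}) ⊊ L(A^{r+1}) ⟺ Hg(A) ⊊ L(A)`** (`dim A ≥ 1`; `Hg ≤ L` always): an abelian variety some power of which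
supports an exotic Hodge class shares this with all its powers. [cite: Milne1999LefschetzClasses, Prop. 4.8 and Remark 4.9 (p. 660)] -/
theorem _root_.Literature.AlgebraicGeometry.Motives.AbelianVariety.mumfordTateGroup_powSucc_lt_lefschetzGroup_iff
    (hA : 1 ≤ A.dim) (r : ℕ) :
    mumfordTateGroup (A.powSucc r).dim (A.powSucc r).X < lefschetzGroup (A.powSucc r).dim (A.powSucc r).X ↔
      mumfordTateGroup A.dim A.X < lefschetzGroup A.dim A.X := by
  rw [lt_iff_le_and_ne, lt_iff_le_and_ne, and_iff_right (A.powSucc r).hodgeGroup_le_specialLefschetzGroup.2,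
    and_iff_right A.hodgeGroup_le_specialLefschetzGroup.2, Ne, Ne, A.mumfordTateGroup_powSucc_eq_lefschetzGroup_iff hA r]

/-- `Hg′(A^{r+1}) ≠ S(A^{r+1}) ⟺ Hg′(A) ≠ S(A)`. [cite: Milne1999LefschetzClasses, Prop. 4.8 and Remark 4.9 (p. 660)] -/
theorem _root_.Literature.AlgebraicGeometry.Motives.AbelianVariety.hodgeGroup_powSucc_ne_specialLefschetzGroup_iff (r : ℕ) :
    hodgeGroup (A.powSucc r).dim (A.powSucc r).X ≠ specialLefschetzGroup (A.powSucc r).dim (A.powSucc r).X ↔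
      hodgeGroup A.dim A.X ≠ specialLefschetzGroup A.dim A.X :=
  not_congr (A.hodgeGroup_powSucc_eq_specialLefschetzGroup_iff r)

/-- **`Hg′(X) = S(X) ⟺ Hg′(A) = S(A)` for every `X` isogenous to a power `A^{r+1}`** («`S(A)` depends only on the isogeny
class», and Prop. 4.8 (c) for powers). [cite: Milne1999LefschetzClasses, §1 p. 644, Prop. 4.8 (p. 660) and Cor. 4.7]
[cite: vanGeemen1994HodgeAV, §3.6–3.7 (p. 236)] -/
theorem hodgeGroup_eq_specialLefschetzGroup_iff_of_isIsogenous_powSucc (r : ℕ)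
    (h : AbelianVariety.IsIsogenous X (A.powSucc r)) :
    hodgeGroup X.dim X.X = specialLefschetzGroup X.dim X.X ↔ hodgeGroup A.dim A.X = specialLefschetzGroup A.dim A.X :=
  (hodgeGroup_eq_specialLefschetzGroup_iff_of_isIsogenous h).trans (A.hodgeGroup_powSucc_eq_specialLefschetzGroup_iff r)

variable {A} in
/-- **`Hg(X) = L(X) ⟺ Hg(A) = L(A)` for every `X` isogenous to a power `A^{r+1}`** (`dim A ≥ 1`).
[cite: Milne1999LefschetzClasses, Prop. 4.8 (p. 660) and Cor. 4.7] [cite: vanGeemen1994HodgeAV, §3.6–3.7 (p. 236)] -/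
theorem mumfordTateGroup_eq_lefschetzGroup_iff_of_isIsogenous_powSucc (hA : 1 ≤ A.dim) (r : ℕ)
    (h : AbelianVariety.IsIsogenous X (A.powSucc r)) :
    mumfordTateGroup X.dim X.X = lefschetzGroup X.dim X.X ↔ mumfordTateGroup A.dim A.X = lefschetzGroup A.dim A.X := by
  have hX : 1 ≤ X.dim := by
    obtain ⟨f, hf⟩ := h
    rw [AbelianVariety.dim_eq_of_isIsogeny hf]
    exact dim_powSucc_pos hA r
  exact (mumfordTateGroup_eq_lefschetzGroup_iff_of_isIsogenous h hX).trans (A.mumfordTateGroup_powSucc_eq_lefschetzGroup_iff hA r)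

end Powers

/-! ### §3 Products and mixed powers -/

section Products

variable (A B : AbelianVariety ℂ)

/-- **`Hg′(A × B) = S(A × B) ⟹ Hg′(A) = S(A)`**: an exotic Hodge class on a power of `A` pulls back to one on the same power
of `A × B` (van Geemen §2.5), so condition (a), hence (c), descends to the factor. (The converse fails in general and is
not asserted.) [cite: Milne1999LefschetzClasses, Prop. 4.8 and Remark 4.9 (p. 660)] [cite: vanGeemen1994HodgeAV, §2.4–2.5 (p. 235)] -/
theorem _root_.Literature.AlgebraicGeometry.Motives.AbelianVariety.hodgeGroup_eq_specialLefschetzGroup_left_of_prod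
    (h : hodgeGroup (A.prod B).dim (A.prod B).X = specialLefschetzGroup (A.prod B).dim (A.prod B).X) :
    hodgeGroup A.dim A.X = specialLefschetzGroup A.dim A.X := by
  rw [AbelianVariety.hodgeGroup_eq_specialLefschetzGroup_iff_forall_isDivisorGenerated, ← isStablyNondegenerate_iff] at h ⊢
  exact h.left_of_prod

/-- **`Hg′(A × B) = S(A × B) ⟹ Hg′(B) = S(B)`.** [cite: Milne1999LefschetzClasses, Prop. 4.8 and Remark 4.9 (p. 660)]
[cite: vanGeemen1994HodgeAV, §2.4–2.5 (p. 235)] -/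
theorem _root_.Literature.AlgebraicGeometry.Motives.AbelianVariety.hodgeGroup_eq_specialLefschetzGroup_right_of_prod
    (h : hodgeGroup (A.prod B).dim (A.prod B).X = specialLefschetzGroup (A.prod B).dim (A.prod B).X) :
    hodgeGroup B.dim B.X = specialLefschetzGroup B.dim B.X := by
  rw [AbelianVariety.hodgeGroup_eq_specialLefschetzGroup_iff_forall_isDivisorGenerated, ← isStablyNondegenerate_iff] at h ⊢
  exact h.right_of_prod

/-- `Hg′(A × B) = S(A × B) ⟹ Hg′(A) = S(A) ∧ Hg′(B) = S(B)`. [cite: Milne1999LefschetzClasses, Prop. 4.8 and Remark 4.9 (p. 660)]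
[cite: vanGeemen1994HodgeAV, §2.4–2.5 (p. 235)] -/
theorem _root_.Literature.AlgebraicGeometry.Motives.AbelianVariety.hodgeGroup_eq_specialLefschetzGroup_of_prod
    (h : hodgeGroup (A.prod B).dim (A.prod B).X = specialLefschetzGroup (A.prod B).dim (A.prod B).X) :
    hodgeGroup A.dim A.X = specialLefschetzGroup A.dim A.X ∧ hodgeGroup B.dim B.X = specialLefschetzGroup B.dim B.X :=
  ⟨A.hodgeGroup_eq_specialLefschetzGroup_left_of_prod B h, A.hodgeGroup_eq_specialLefschetzGroup_right_of_prod B h⟩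

variable {A} in
/-- **`Hg(A × B) = L(A × B) ⟹ Hg(A) = L(A)`** for a positive-dimensional factor `A`.
[cite: Milne1999LefschetzClasses, Prop. 4.8 and Remark 4.9 (p. 660)] [cite: vanGeemen1994HodgeAV, §2.4–2.5 (p. 235)] -/
theorem _root_.Literature.AlgebraicGeometry.Motives.AbelianVariety.mumfordTateGroup_eq_lefschetzGroup_left_of_prod
    (hA : 1 ≤ A.dim)
    (h : mumfordTateGroup (A.prod B).dim (A.prod B).X = lefschetzGroup (A.prod B).dim (A.prod B).X) :
    mumfordTateGroup A.dim A.X = lefschetzGroup A.dim A.X := by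
  have hAB : 1 ≤ (A.prod B).dim := by rw [AbelianVariety.dim_prod]; omega
  rw [← (A.prod B).hodgeGroup_eq_specialLefschetzGroup_iff hAB] at h
  rw [← A.hodgeGroup_eq_specialLefschetzGroup_iff hA]
  exact A.hodgeGroup_eq_specialLefschetzGroup_left_of_prod B h

variable {B} in
/-- **`Hg(A × B) = L(A × B) ⟹ Hg(B) = L(B)`** for a positive-dimensional factor `B`.
[cite: Milne1999LefschetzClasses, Prop. 4.8 and Remark 4.9 (p. 660)] [cite: vanGeemen1994HodgeAV, §2.4–2.5 (p. 235)] -/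
theorem _root_.Literature.AlgebraicGeometry.Motives.AbelianVariety.mumfordTateGroup_eq_lefschetzGroup_right_of_prod
    (hB : 1 ≤ B.dim)
    (h : mumfordTateGroup (A.prod B).dim (A.prod B).X = lefschetzGroup (A.prod B).dim (A.prod B).X) :
    mumfordTateGroup B.dim B.X = lefschetzGroup B.dim B.X := by
  have hAB : 1 ≤ (A.prod B).dim := by rw [AbelianVariety.dim_prod]; omega
  rw [← (A.prod B).hodgeGroup_eq_specialLefschetzGroup_iff hAB] at h
  rw [← B.hodgeGroup_eq_specialLefschetzGroup_iff hB]
  exact A.hodgeGroup_eq_specialLefschetzGroup_right_of_prod B h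

/-- **`Hg(A) ⊊ L(A) ⟹ Hg(A × B) ⊊ L(A × B)`** (`dim A ≥ 1`): a product inherits the exotic classes of (the powers of) its
factors. [cite: Milne1999LefschetzClasses, Prop. 4.8 and Remark 4.9 (p. 660)] [cite: vanGeemen1994HodgeAV, §2.5 (p. 235)] -/
theorem _root_.Literature.AlgebraicGeometry.Motives.AbelianVariety.mumfordTateGroup_prod_lt_lefschetzGroup_of_left
    {A : AbelianVariety ℂ} (B : AbelianVariety ℂ) (hA : 1 ≤ A.dim)
    (h : mumfordTateGroup A.dim A.X < lefschetzGroup A.dim A.X) :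
    mumfordTateGroup (A.prod B).dim (A.prod B).X < lefschetzGroup (A.prod B).dim (A.prod B).X :=
  lt_of_le_of_ne (A.prod B).hodgeGroup_le_specialLefschetzGroup.2
    fun e ↦ h.ne (AbelianVariety.mumfordTateGroup_eq_lefschetzGroup_left_of_prod B hA e)

/-- **`Hg′(A^{M+1} × B^{N+1}) = S(A^{M+1} × B^{N+1}) ⟺ Hg′(A × B) = S(A × B)`** (condition (a) for the mixed powers and for
`A × B` agree: `isStablyNondegenerate_powSucc_prod_powSucc_iff`). [cite: Milne1999LefschetzClasses, Prop. 4.8 (p. 660) and Cor. 4.7]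
[cite: vanGeemen1994HodgeAV, §3.6–3.7 (p. 236)] -/
theorem _root_.Literature.AlgebraicGeometry.Motives.AbelianVariety.hodgeGroup_powSucc_prod_powSucc_eq_specialLefschetzGroup_iff
    (M N : ℕ) :
    hodgeGroup ((A.powSucc M).prod (B.powSucc N)).dim ((A.powSucc M).prod (B.powSucc N)).X =
        specialLefschetzGroup ((A.powSucc M).prod (B.powSucc N)).dim ((A.powSucc M).prod (B.powSucc N)).X ↔
      hodgeGroup (A.prod B).dim (A.prod B).X = specialLefschetzGroup (A.prod B).dim (A.prod B).X := by
  rw [((A.powSucc M).prod (B.powSucc N)).hodgeGroup_eq_specialLefschetzGroup_iff_forall_isDivisorGenerated,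
    (A.prod B).hodgeGroup_eq_specialLefschetzGroup_iff_forall_isDivisorGenerated, ← isStablyNondegenerate_iff,
    ← isStablyNondegenerate_iff, isStablyNondegenerate_powSucc_prod_powSucc_iff]

/-- `dim A ≤ dim A^{M+1}`. [folklore] -/
private theorem dim_le_dim_powSucc_aux (A : AbelianVariety ℂ) : ∀ M : ℕ, A.dim ≤ (A.powSucc M).dim
  | 0 => le_rfl
  | M + 1 => by
    change A.dim ≤ ((A.powSucc M).prod A).dim
    rw [AbelianVariety.dim_prod]
    omega

/-- **`Hg(A^{M+1} × B^{N+1}) = L(A^{M+1} × B^{N+1}) ⟺ Hg(A × B) = L(A × B)`** (`dim (A × B) ≥ 1`).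
[cite: Milne1999LefschetzClasses, Prop. 4.8 (p. 660) and Cor. 4.7] [cite: vanGeemen1994HodgeAV, §3.6–3.7 (p. 236)] -/
theorem _root_.Literature.AlgebraicGeometry.Motives.AbelianVariety.mumfordTateGroup_powSucc_prod_powSucc_eq_lefschetzGroup_iff
    (hAB : 1 ≤ (A.prod B).dim) (M N : ℕ) :
    mumfordTateGroup ((A.powSucc M).prod (B.powSucc N)).dim ((A.powSucc M).prod (B.powSucc N)).X =
        lefschetzGroup ((A.powSucc M).prod (B.powSucc N)).dim ((A.powSucc M).prod (B.powSucc N)).X ↔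
      mumfordTateGroup (A.prod B).dim (A.prod B).X = lefschetzGroup (A.prod B).dim (A.prod B).X := by
  have hMN : 1 ≤ ((A.powSucc M).prod (B.powSucc N)).dim := by
    rw [AbelianVariety.dim_prod] at hAB ⊢
    have hA := dim_le_dim_powSucc_aux A M
    have hB := dim_le_dim_powSucc_aux B N
    omega
  rw [← ((A.powSucc M).prod (B.powSucc N)).hodgeGroup_eq_specialLefschetzGroup_iff hMN,
    ← (A.prod B).hodgeGroup_eq_specialLefschetzGroup_iff hAB]
  exact A.hodgeGroup_powSucc_prod_powSucc_eq_specialLefschetzGroup_iff B M N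

end Products

end Literature.AlgebraicGeometry.Milne1999

end
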